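import Literature.MathematicalPhysics.QuantumFieldTheory.Balaban1983to89.B11Eq174Chart

/-!
# `Balaban1983to89.B11Prop6Model` — T. Bałaban, *The variational problem and background fields in renormalization group
# method for lattice gauge theories*, Commun. Math. Phys. **102** (1985) 277–309 [Balaban1985Variational], **Proposition 6**
# (pp. 295–296): the typed statement of record `B11.Prop6Printed B₀ B₃ C₁ fam` INHABITED BY NAME for the model family of the
# contraction scheme (116)–(121) (kind «model-instance»: carriers = complex Banach spaces; the analytic inputs of the printed proof
# — the norm of 𝔊 = G₁𝔓* «By Theorem 3.13 of [5]» and Proposition 4 for W = (δ/δA′)V — are DATA of the index)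

statement-level skeleton of published theorems with citation tags; proofs where landed; nothing here is a claim
about the Yang–Mills mass gap

PDF held: `paper:balaban1985-cmp102-variational-background` (journal page = PDF page + 276); Sect. E pp. 294–296 (PDF 18–20) and
p. 293 (PDF 17, display (103)) read from the held text by this seat (2026-08-21); the verbatim Sect. E text is quoted in full in the
header of the sibling `B11Prop6Scheme` (render-checked there).

WHAT IS REPRODUCED.  SKELETON row `B11.Prop6` (reader r08 `ROWS-B11.md`; decl of record `B11.Prop6Printed`, B11.lean, typed-existing
over the abstract Landau-gauge carrier `B11.LGData`; INTERFACES §1 letter (L7) of the NE9 letter map).  THE PRINTED TEXT (p. 295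
[PDF 19] – p. 296 [PDF 20], verbatim): *"Proposition 6. There exists a positive, absolute constant a₄ such, that for ε₄ ≤ a₄ and ε₁
satisfying 2B₀C₁B₃ε₁ ≤ ε₄ Eq. (111) has exactly one solution in the space (115). This solution satisfies the bounds (115) with
ε₄ = 3B₀C₁B₃ε₁. Moreover, if we replace the configuration H₁B by an arbitrary configuration 𝔄 with values in the complexified Lie
algebra, and satisfying the same bounds as H₁B, then the above statement is again true and the solution is an analytic function of
𝔄."*  With (111) p. 294 *"A₁ + 𝔊J + 𝔊((δ/δA′)V)(A₁ + H₁B) = 0"*, (115) p. 294 *"max{|A₁|_{(−1)}, |∇A₁|_{(−2)}} < ε₄"*, (103)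
p. 293 *"|H₁B| < B₀2dLC₁ε₁(L^jη)^{−1}, |∇H₁B| < B₀2dLC₁ε₁(L^jη)^{−2} on Ω_j"*, (28) p. 282 (|J| < C₁B₃ε₁(L^jη)^{−3}, *"the bound
holds by the assumption (14)"*), (117) p. 295 *"By Theorem 3.13 of [5] the norm max{|·|_{(−1)}, |∇·|_{(−2)}} of the transformation can
be estimated by B₀|J|_{(−3)} + B₀|((δ/δA′)V)(A₁ + H₁B)|_{(−3)}"*.

THE PRINTED PROOF, AND WHERE IT IS IN THE TREE.  The whole of Sect. E p. 295 — (116) the fixed-point map, (117) its norm bound, (118)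
self-map of (115), (119)–(120) the contraction estimate by the Cauchy formula, (121) the contraction conditions, the nested-balls bound
«with ε₄ = 3B₀C₁B₃ε₁», and p. 296's successive-approximation analyticity — is kernel-checked over ABSTRACT complex Banach spaces in the
sibling `B11Prop6Scheme` (unit b2b-balaban-b11-g10: `mapT`, `bound_117`, `mapsTo_118`, `lipschitz_120`, `existsUnique_solution`,
`norm_solution_le`, `prop6_solution`, `prop6_bound_printed`, `solution_analytic`; a₄ = min{a₃/4, (16B₀C₄)⁻¹} by `le_a4_iff` and
`B11.ineq118_121`) and packaged as a solution OPERATOR in `B11Eq174Chart` (P2 seat p07 g4: `solA`, `Regime`, `Regime.ofProp6`,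
`Regime.solA_differentiableOn`).  Until now none of this was connected to the typed statement `B11.Prop6Printed` (its header:
«unchanged, not imported into any proof here»).  THIS FILE supplies the connection: §1 a MODEL FAMILY of `B11.LGData` carriers built from
scheme data (`SchemeDatum`, `SchemeDatum.toLGData`), §2 two lemmas — (111) ⟺ fixed point of (116) (`eq111_iff_fixed`) and «the
solution lies in the OPEN ball (115)» (`norm_lt_of_fixed`, the strict form of (118) needed because (115) has strict inequalities) —,
§3 **`prop6Printed_model : B11.Prop6Printed B₀ B₃ C₁ (fun i => (δ i).toLGData C₁)`** for EVERY family `δ` of scheme data with the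
fixed printed constants (one a₄ = min{a₃/4, (16B₀C₄)⁻¹} chosen before the index, as the typed quantifier order demands), and §4 the
dictionary `prop4Printed_model` recording that on this family the typed Proposition 4 (`B11.Prop4Printed`) is exactly the INPUT
`Prop4Hyp` (Prop. 4 is NOT proved here or anywhere in the tree for the lattice objects).

MODEL / DECLARED READINGS (each a field of `SchemeDatum.toLGData`; DIVERGENCE D-B11-20 of `B11Prop6Scheme` applies verbatim).
 (M1) CARRIERS: for each index `i` the configurations A₁ of (115) form a complex Banach space `𝒴 i` whose norm stands for
      max{|·|_{(−1)}, |∇·|_{(−2)}} (`nMax`), the currents a complex normed space `𝒵 i` whose norm stands for |·|_{(−3)}; backgrounds U₀ and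
      boundary data V are arbitrary types `Cfg i`, `Bdry i`.  On the finite lattices of the paper these spaces are finite-dimensional.
 (M2) INPUTS AS DATA: `G : 𝒵 →L[ℂ] 𝒴` with ‖Gf‖ ≤ B₀‖f‖ (the (117) sentence «By Theorem 3.13 of [5]»; [5] = B9, `B9.Thm313Printed`, a
      CITATION STATEMENT in the tree) and `W : 𝒴 → 𝒵` with `B11Prop6Scheme.Prop4Hyp W C₄ a₃` (Proposition 4 (97)–(98) + analyticity,
      `B11.Prop4Printed`, TYPED in the tree); the current `J U₀ : 𝒵` of (27) and the configuration `H₁B V U₀ : 𝒴` of (103) are data.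
 (M3) HYPOTHESIS (14) is read as its two consequences that Sect. E uses: `Sat14 a b V U₀ := ‖J U₀‖ ≤ a ∧ ‖H₁B V U₀‖ < 2·(dim·L)·B₀·b` —
      at the printed parameters a = C₁B₃ε₁, b = C₁ε₁ these are (28) «by the assumption (14)» and (103) (via |B| < 2dLC₁ε₁ (20) and
      Thm 3.12 [5]); `dim`, `L` are the model's own `LGData.dim`, `LGData.L`, with the located condition dL ≤ B₃ of `prop6_solution`
      («true for the B₃ of (162)») as a datum field.
 (M4) (111) LITERALLY: `Sol111 V U₀ A₁ := A₁ + G(J U₀) + G(W(A₁ + H₁B V U₀)) = 0`, `Sol111G U₀ 𝔄 A₁` the same with 𝔄 for H₁B;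
      `LikeH1B ε₁ U₀ 𝔄 := ‖𝔄‖ < 2·(dim·L)·B₀·C₁ε₁` («satisfying the same bounds as H₁B» = (103)).
 (M5) «ANALYTIC FUNCTION OF 𝔄»: `SolAnalytic U₀ ε₁ ε₄` := for every open V ⊆ ℂ and every holomorphic family σ ↦ 𝔄_σ : V → 𝒴 inside the
      region (103), σ ↦ 𝒜(𝔄_σ) is holomorphic on V, where 𝒜 = `B11Eq174Chart.solA G 0 W (J U₀) ε₄` is the solution selector of (116) in the
      ball ‖X‖ ≤ ε₄ (= THE solution, by uniqueness, in the regime) — holomorphy along holomorphic curves, the notion typed throughout the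
      lineage (`B13Contraction113`, `B11Prop6Scheme` §5); on finite-dimensional 𝒴 it is the printed analyticity.
 (M6) INERT FIELDS: the fields of `B11.LGData` that Proposition 6 does not mention (the Sect. A–C predicates `In18`, `Crit`, `In19_21`,
      `CritL`, `Restricted`, `toAxial`, `Def47`, `T47`, `normD`, `kerD`, `T112`, the geometry `Cell`/`Site`/`scale`/`dist`/`eta`) are
      filled with inert values and carry NO claim; `In43`/`nM1`/`dVn`/`dVAnalytic` are the norm / W readings (used only in §4).
 (M7) CONSTANTS: the theorem asks 0 < B₀, C₄, a₃, B₃, C₁ (all printed constants are positive); «absolute» a₄ = (d, L)-dependent through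
      a₃, C₄, B₀ (DIVERGENCE D-B11-3), here visibly a₄ = min{a₃/4, (16B₀C₄)⁻¹}.
HONEST SCOPE.  This inhabits the typed Proposition 6 for the scheme's model family; it does NOT construct 𝔊, (δ/δA′)V, H₁, J on Bałaban's
lattice (INTERFACES §3 «NE9 letters (L1)–(L8)», socket C19′ — frozen under ruling e34b3e0c (0)), and proves nothing of [5] Thm 3.13 or of
Prop. 4.  Mega-formalization `lit-balaban`, HOME `run/shared/lean/pub/lit-balaban/`, reader/typer seat r08 gen 6 (unit `lit-balaban-r08`).
Imports the sibling `B11Eq174Chart` only (→ `B11Prop6Scheme` → `B11`, `B13Contraction113`); modifies nothing.  Net new unproved facts: 0.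
-/

noncomputable section

open Metric Set

namespace Literature.MathematicalPhysics.QuantumFieldTheory.Balaban1983to89.B11Prop6Model

open B13Contraction113 (QuadAnalytic)
open B11Prop6Scheme (mapT mapT_noLinear Prop4Hyp prop6_solution prop6_bound_printed le_a4_iff bound_117 norm_arg_lt)
open B11Eq174Chart (solA Regime)

/-! ## §1 The scheme datum and its reading as a `B11.LGData` carrier -/

/-- **A datum of the contraction scheme of Sect. E** over fixed carriers `𝒴` (configurations A₁, norm of (115)), `𝒵` (currents,
|·|_{(−3)}), `Cfg` (backgrounds U₀), `Bdry` (boundary data V) and fixed printed constants B₀ (norm of 𝔊, (117)), C₄, a₃ (Prop. 4),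
B₃ ((162)): the scale data `L`, `dim` (= d) with dL ≤ B₃; the propagator `G` = 𝔊 = G₁𝔓* with *"By Theorem 3.13 of [5] the norm … can be
estimated by B₀|·|_{(−3)}"* (117); `W` = (δ/δA′)V with Proposition 4 in the Fréchet form `Prop4Hyp W C₄ a₃`; the current `J U₀` of (27)
and the configuration `H₁B V U₀` of (103).  A MODEL datum: the two analytic inputs are hypotheses carried by the index, nothing of [5]
or of Prop. 4 is asserted. [cite: Balaban1985Variational, (111), (115)–(117) pp.294–295] -/
structure SchemeDatum (𝒴 𝒵 Cfg Bdry : Type) [NormedAddCommGroup 𝒴] [NormedSpace ℂ 𝒴] [NormedAddCommGroup 𝒵]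
    [NormedSpace ℂ 𝒵] (B₀ C₄ a₃ B₃ : ℝ) where
  /-- the scale factor L (> 1 in print) -/
  L : ℝ
  /-- the dimension d -/
  dim : ℕ
  /-- 𝔊 = G₁𝔓* ((110)–(111), [5] (3.148)) -/
  G : 𝒵 →L[ℂ] 𝒴
  /-- W = (δ/δA′)V, the functional derivative of the functional V of (80)–(81) -/
  W : 𝒴 → 𝒵
  /-- the current J of (27) determined by the background U₀ -/
  J : Cfg → 𝒵
  /-- the configuration H₁B, B determined by V and U₀ through (1.31) of [6] ((20)) -/
  H₁B : Bdry → Cfg → 𝒴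
  /-- (117): «By Theorem 3.13 of [5]» ‖𝔊f‖ ≤ B₀|f|_{(−3)} — an INPUT -/
  norm_G : ∀ f, ‖G f‖ ≤ B₀ * ‖f‖
  /-- Proposition 4 (97)–(98) and the analyticity of (δ/δA′)V — an INPUT -/
  prop4 : Prop4Hyp W C₄ a₃
  L_nonneg : 0 ≤ L
  /-- dL ≤ B₃ (the located condition of `B11Prop6Scheme.prop6_solution`, true for the B₃ of (162)) -/
  dL_le : (dim : ℝ) * L ≤ B₃

variable {𝒴 𝒵 Cfg Bdry : Type} [NormedAddCommGroup 𝒴] [NormedSpace ℂ 𝒴] [NormedAddCommGroup 𝒵] [NormedSpace ℂ 𝒵]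
  {B₀ C₄ a₃ B₃ : ℝ}

/-- **The `B11.LGData` carrier of a scheme datum** (readings (M1)–(M6) of the header): `Fld := 𝒴`, `nMax := ‖·‖` (the norm of
(115)); `Sat14 a b V U₀ := ‖J U₀‖ ≤ a ∧ ‖H₁B V U₀‖ < 2·(dim·L)·B₀·b` ((28) and (103), the two consequences of (14) used in Sect. E);
`Sol111` = Eq. (111) *"A₁ + 𝔊J + 𝔊((δ/δA′)V)(A₁ + H₁B) = 0"* literally, `Sol111G` the same with an arbitrary 𝔄; `LikeH1B ε₁ U₀ 𝔄 :=
‖𝔄‖ < 2·(dim·L)·B₀·C₁ε₁` ((103)); `SolAnalytic U₀ ε₁ ε₄` = holomorphy of σ ↦ `solA G 0 W (J U₀) ε₄ (𝔄_σ)` along every holomorphic family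
σ ↦ 𝔄_σ inside the region (103); `dVn := ‖W ·‖`, `dVAnalytic U₀ ε := DifferentiableOn ℂ W {‖·‖ < ε}`; every other field inert.
[cite: Balaban1985Variational, (14) p.280, (103) p.293, (111) p.294, (115) p.294] -/
def SchemeDatum.toLGData (D : SchemeDatum 𝒴 𝒵 Cfg Bdry B₀ C₄ a₃ B₃) (C₁ : ℝ) : B11.LGData where
  Cfg := Cfg
  Bdry := Bdry
  Pert := 𝒴
  GT := PUnit
  Fld := 𝒴
  Cell := PUnit
  Site := PUnit
  L := D.L
  eta := 1
  dim := D.dim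
  scale := fun _ => 0
  cscale := fun _ => 0
  dist := fun _ _ => 0
  Sat14 := fun a b V U₀ => ‖D.J U₀‖ ≤ a ∧ ‖D.H₁B V U₀‖ < 2 * ((D.dim : ℝ) * D.L) * B₀ * b
  In18 := fun _ _ _ _ => True
  Crit := fun _ _ _ => True
  In19_21 := fun _ _ _ _ => True
  CritL := fun _ _ _ => True
  Restricted := fun _ _ => True
  toAxial := fun _ U₁ _ => U₁
  In43 := fun _ ε A => ‖A‖ < ε
  nM1 := fun _ A => ‖A‖
  Def47 := fun _ _ => True
  T47 := fun _ A => A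
  normD := fun _ _ => 0
  kerD := fun _ _ _ _ => 0
  nMax := fun _ A => ‖A‖
  dVn := fun _ A => ‖D.W A‖
  dVAnalytic := fun _ ε => DifferentiableOn ℂ D.W {Y : 𝒴 | ‖Y‖ < ε}
  Sol111 := fun V U₀ A₁ => A₁ + D.G (D.J U₀) + D.G (D.W (A₁ + D.H₁B V U₀)) = 0
  T112 := fun V U₀ A₁ => A₁ + D.H₁B V U₀
  LikeH1B := fun ε₁ _ 𝔄 => ‖𝔄‖ < 2 * ((D.dim : ℝ) * D.L) * B₀ * C₁ * ε₁
  Sol111G := fun U₀ 𝔄 A₁ => A₁ + D.G (D.J U₀) + D.G (D.W (A₁ + 𝔄)) = 0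
  SolAnalytic := fun U₀ ε₁ ε₄ => ∀ V : Set ℂ, IsOpen V → ∀ 𝔄f : ℂ → 𝒴, DifferentiableOn ℂ 𝔄f V →
      (∀ σ ∈ V, ‖𝔄f σ‖ < 2 * ((D.dim : ℝ) * D.L) * B₀ * C₁ * ε₁) →
      DifferentiableOn ℂ (fun σ => solA D.G 0 D.W (D.J U₀) ε₄ (𝔄f σ)) V

/-- Unfolding: the model's hypothesis (14) at the printed parameters a = C₁B₃ε₁, b = C₁ε₁ is (28) ∧ (103).
[cite: Balaban1985Variational, (28) p.282, (103) p.293] -/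
theorem SchemeDatum.sat14_iff (D : SchemeDatum 𝒴 𝒵 Cfg Bdry B₀ C₄ a₃ B₃) (C₁ ε₁ : ℝ) (V : Bdry) (U₀ : Cfg) :
    (D.toLGData C₁).Sat14 (C₁ * B₃ * ε₁) (C₁ * ε₁) V U₀ ↔
      ‖D.J U₀‖ ≤ C₁ * B₃ * ε₁ ∧ ‖D.H₁B V U₀‖ < 2 * ((D.dim : ℝ) * D.L) * B₀ * C₁ * ε₁ := by
  show (_ ∧ ‖D.H₁B V U₀‖ < 2 * ((D.dim : ℝ) * D.L) * B₀ * (C₁ * ε₁)) ↔ _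
  rw [← mul_assoc]

/-- Unfolding: the model's `Sol111` is Eq. (111) literally. [cite: Balaban1985Variational, (111) p.294] -/
theorem SchemeDatum.sol111_iff (D : SchemeDatum 𝒴 𝒵 Cfg Bdry B₀ C₄ a₃ B₃) (C₁ : ℝ) (V : Bdry) (U₀ : Cfg) (A₁ : 𝒴) :
    (D.toLGData C₁).Sol111 V U₀ A₁ ↔ A₁ + D.G (D.J U₀) + D.G (D.W (A₁ + D.H₁B V U₀)) = 0 :=
  Iff.rfl

/-! ## §2 Two lemmas: (111) ⟺ fixed point of (116); the solution lies in the OPEN ball (115) -/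

/-- **(111) ⟺ (116)** p. 295: *"A solution of Eq. (111) is a fixed point of the transformation A₁ → −𝔊J − 𝔊((δ/δA′)V)(A₁ + H₁B).
(116)"* — `X + GJ + G(W(X + 𝔄)) = 0 ↔ mapT G 0 W J 𝔄 X = X`. [cite: Balaban1985Variational, (116) p.295] -/
theorem eq111_iff_fixed (G : 𝒵 →L[ℂ] 𝒴) (W : 𝒴 → 𝒵) (J : 𝒵) (𝔄 X : 𝒴) :
    X + G J + G (W (X + 𝔄)) = 0 ↔ mapT G 0 W J 𝔄 X = X := by
  rw [mapT_noLinear]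
  generalize G (W (X + 𝔄)) = K
  constructor
  · intro h
    have h' : X = -G J - K := by
      rw [← sub_eq_zero, ← h]; abel
    rw [h']
  · intro h
    rw [← h]; abel

/-- **The solution lies in the open ball (115)** (the space (115) p. 294 has STRICT inequalities *"max{|A₁|_{(−1)}, |∇A₁|_{(−2)}} <
ε₄"*): a fixed point X of (116) with ‖X‖ ≤ ε₄ has ‖X‖ < ε₄, because in (117)–(118) the argument X + 𝔄 has norm STRICTLY below
ε₄ + a (‖𝔄‖ < a strict, as printed |H₁B| < B₀2dLC₁ε₁ (103)) and B₀C₄ > 0, so ‖X‖ = ‖TX‖ ≤ B₀‖J‖ + B₀C₄‖X + 𝔄‖² < B₀j + B₀C₄(ε₄ +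
a)² ≤ ε₄ by (118). [cite: Balaban1985Variational, (115)–(118) pp.294–295] -/
theorem norm_lt_of_fixed {G : 𝒵 →L[ℂ] 𝒴} {W : 𝒴 → 𝒵} (hG : ∀ f, ‖G f‖ ≤ B₀ * ‖f‖) (hW : QuadAnalytic W C₄ a₃)
    (hB₀ : 0 < B₀) (hC₄ : 0 < C₄) {J : 𝒵} {j : ℝ} (hJ : ‖J‖ ≤ j) {𝔄 X : 𝒴} {a ε₄ : ℝ} (h𝔄 : ‖𝔄‖ < a)
    (hdom : ε₄ + a ≤ a₃) (hself : B₀ * j + B₀ * C₄ * (ε₄ + a) ^ 2 ≤ ε₄) (hX : ‖X‖ ≤ ε₄)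
    (hfix : mapT G 0 W J 𝔄 X = X) : ‖X‖ < ε₄ := by
  have harg : ‖X + 𝔄‖ < ε₄ + a := norm_arg_lt h𝔄 hX
  have h0 : 0 ≤ ‖X + 𝔄‖ := norm_nonneg _
  have hΛ : ∀ Y : 𝒴, ‖(0 : 𝒴 →L[ℂ] 𝒴) Y‖ ≤ 0 * ‖Y‖ := fun Y => by simp
  have h117 := bound_117 (J := J) (𝔄 := 𝔄) (X := X) hG hΛ hW hB₀.le (harg.trans_le hdom)
  have hsq : ‖X + 𝔄‖ ^ 2 < (ε₄ + a) ^ 2 := by nlinarith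
  have e1 : B₀ * ‖J‖ ≤ B₀ * j := mul_le_mul_of_nonneg_left hJ hB₀.le
  have e2 : B₀ * C₄ * ‖X + 𝔄‖ ^ 2 < B₀ * C₄ * (ε₄ + a) ^ 2 := mul_lt_mul_of_pos_left hsq (mul_pos hB₀ hC₄)
  calc ‖X‖ = ‖mapT G 0 W J 𝔄 X‖ := by rw [hfix]
    _ ≤ B₀ * ‖J‖ + 0 * ‖X + 𝔄‖ + B₀ * C₄ * ‖X + 𝔄‖ ^ 2 := h117
    _ < B₀ * j + B₀ * C₄ * (ε₄ + a) ^ 2 := by linarith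
    _ ≤ ε₄ := hself

/-! ## §3 Proposition 6 for the model family -/

section Family

variable {I : Type} (𝒴f 𝒵f Cfgf Bdryf : I → Type) [∀ i, NormedAddCommGroup (𝒴f i)] [∀ i, NormedSpace ℂ (𝒴f i)]
  [∀ i, CompleteSpace (𝒴f i)] [∀ i, NormedAddCommGroup (𝒵f i)] [∀ i, NormedSpace ℂ (𝒵f i)]

/-- **The Sect. E conclusion for one datum 𝔄** (= H₁B, or Prop. 6's «arbitrary configuration 𝔄 … satisfying the same bounds»):
under ε₄ ≤ a₄ (unfolded: 4ε₄ ≤ a₃ ∧ 16B₀C₄ε₄ ≤ 1), 2B₀C₁B₃ε₁ ≤ ε₄, ‖J‖ ≤ C₁B₃ε₁ ((28)) and ‖𝔄‖ < 2dLB₀C₁ε₁ ((103)), Eq. (111)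
with datum 𝔄 has a solution A₁ in the OPEN ball (115), of norm < 3B₀C₁B₃ε₁, and every solution in the open ball equals it —
`B11Prop6Scheme.prop6_solution` + `norm_lt_of_fixed` + `prop6_bound_printed`. [cite: Balaban1985Variational, Prop. 6 p.295] -/
theorem exists_solution_open {𝒴 𝒵 : Type} [NormedAddCommGroup 𝒴] [NormedSpace ℂ 𝒴] [CompleteSpace 𝒴]
    [NormedAddCommGroup 𝒵] [NormedSpace ℂ 𝒵] {G : 𝒵 →L[ℂ] 𝒴} {W : 𝒴 → 𝒵} {B₀ C₄ a₃ : ℝ}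
    (hG : ∀ f, ‖G f‖ ≤ B₀ * ‖f‖) (hW : QuadAnalytic W C₄ a₃) (hB₀ : 0 < B₀) (hC₄ : 0 < C₄)
    {dL C₁ B₃ ε₁ ε₄ : ℝ} (hdL : 0 ≤ dL) (hC₁ : 0 < C₁) (hB₃ : 0 < B₃) (hε₁ : 0 < ε₁) (hdLB₃ : dL ≤ B₃)
    (h1 : 2 * B₀ * C₁ * B₃ * ε₁ ≤ ε₄) (h2 : 4 * ε₄ ≤ a₃) (h3 : 16 * B₀ * C₄ * ε₄ ≤ 1) {J : 𝒵}
    (hJ : ‖J‖ ≤ C₁ * B₃ * ε₁) {𝔄 : 𝒴} (h𝔄 : ‖𝔄‖ < 2 * dL * B₀ * C₁ * ε₁) :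
    ∃ A₁ : 𝒴, ‖A₁‖ < ε₄ ∧ A₁ + G J + G (W (A₁ + 𝔄)) = 0 ∧ ‖A₁‖ < 3 * B₀ * C₁ * B₃ * ε₁ ∧
      ∀ A₁' : 𝒴, ‖A₁'‖ < ε₄ → A₁' + G J + G (W (A₁' + 𝔄)) = 0 → A₁' = A₁ := by
  have hε₄ : 0 ≤ ε₄ := le_trans (by positivity) h1
  obtain ⟨⟨X, ⟨hXn, hXfix⟩, huniq⟩, hbound⟩ :=
    prop6_solution hG hW hB₀.le hC₄.le hdL hC₁.le hε₁.le hε₄ hdLB₃ h1 h2 h3 hJ h𝔄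
  obtain ⟨⟨hdom, h118⟩, -⟩ :=
    B11.ineq118_121 dL B₀ C₁ C₄ B₃ a₃ ε₁ ε₄ hdL hB₀.le hC₁.le hC₄.le hε₁.le hε₄ hdLB₃ h1 h2 h3
  have hself : B₀ * (C₁ * B₃ * ε₁) + B₀ * C₄ * (ε₄ + 2 * dL * B₀ * C₁ * ε₁) ^ 2 ≤ ε₄ := by
    have e : B₀ * (C₁ * B₃ * ε₁) = B₀ * C₁ * B₃ * ε₁ := by ring
    rw [e]; exact h118
  have hXlt : ‖X‖ < ε₄ := norm_lt_of_fixed hG hW hB₀ hC₄ hJ h𝔄 hdom hself hXn hXfix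
  refine ⟨X, hXlt, (eq111_iff_fixed G W J 𝔄 X).2 hXfix,
    prop6_bound_printed (by positivity) (hbound X hXn hXfix), fun A₁' hA₁' hsol => ?_⟩
  exact huniq A₁' ⟨hA₁'.le, (eq111_iff_fixed G W J 𝔄 A₁').1 hsol⟩

/-- **Proposition 6 (pp. 295–296) — the typed statement of record `B11.Prop6Printed B₀ B₃ C₁ fam` INHABITED BY NAME for the model
family** of scheme data `δ i` (carriers `𝒴f i`, `𝒵f i`, `Cfgf i`, `Bdryf i` varying with the index; printed constants fixed): with
ONE a₄ := min{a₃/4, (16B₀C₄)⁻¹} chosen before the index, for ε₄ ≤ a₄ and 2B₀C₁B₃ε₁ ≤ ε₄ and every (V, U₀) satisfying the model's (14)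
— (i) Eq. (111) has exactly one solution in the space (115), of norm < 3B₀C₁B₃ε₁; (ii) the same for an arbitrary 𝔄 with the bounds
(103) in place of H₁B; (iii) the solution is an analytic function of 𝔄 (reading (M5)).  Proof = the printed Sect. E argument as
kernel-checked in `B11Prop6Scheme` (`prop6_solution`) and `B11Eq174Chart` (`Regime.ofProp6`, `Regime.solA_differentiableOn`).  The
inputs «Theorem 3.13 of [5]» and Proposition 4 are data of the index (NOT proved). [cite: Balaban1985Variational, Prop. 6 pp.295–296] -/
theorem prop6Printed_model {B₀ C₄ a₃ B₃ C₁ : ℝ} (hB₀ : 0 < B₀) (hC₄ : 0 < C₄) (ha₃ : 0 < a₃) (hB₃ : 0 < B₃)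
    (hC₁ : 0 < C₁) (δ : ∀ i, SchemeDatum (𝒴f i) (𝒵f i) (Cfgf i) (Bdryf i) B₀ C₄ a₃ B₃) :
    B11.Prop6Printed B₀ B₃ C₁ (fun i => (δ i).toLGData C₁) := by
  refine ⟨min (a₃ / 4) (1 / (16 * B₀ * C₄)), lt_min (by positivity) (by positivity), ?_⟩
  intro i ε₁ ε₄ hε₁ hε₄a h1 V U₀ h14
  obtain ⟨h2, h3⟩ := (le_a4_iff (mul_pos hB₀ hC₄)).1 hε₄a
  obtain ⟨hJ, hH⟩ := ((δ i).sat14_iff C₁ ε₁ V U₀).1 h14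
  have hdL : 0 ≤ ((δ i).dim : ℝ) * (δ i).L := mul_nonneg (Nat.cast_nonneg _) (δ i).L_nonneg
  have hε₄ : 0 ≤ ε₄ := le_trans (by positivity) h1
  have hWq : QuadAnalytic (δ i).W C₄ a₃ := (δ i).prop4.quadAnalytic
  refine ⟨?_, ?_, ?_⟩
  · -- (i) the datum H₁B
    obtain ⟨A₁, hA, hsol, hA3, huniq⟩ := exists_solution_open (δ i).norm_G hWq hB₀ hC₄ hdL hC₁ hB₃ hε₁
      (δ i).dL_le h1 h2 h3 hJ hH
    exact ⟨A₁, hA, hsol, hA3, huniq⟩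
  · -- (ii) an arbitrary 𝔄 «satisfying the same bounds as H₁B»
    intro 𝔄 h𝔄
    obtain ⟨A₁, hA, hsol, -, huniq⟩ := exists_solution_open (δ i).norm_G hWq hB₀ hC₄ hdL hC₁ hB₃ hε₁
      (δ i).dL_le h1 h2 h3 hJ h𝔄
    exact ⟨A₁, hA, hsol, huniq⟩
  · -- (iii) «the solution is an analytic function of 𝔄»
    intro Vs hVs 𝔄f h𝔄d h𝔄b
    have R := Regime.ofProp6 (𝒢 := (δ i).G) (W := (δ i).W) (δ i).norm_G hWq hB₀.le hC₄.le hdL hC₁.le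
      hε₁.le hε₄ (δ i).dL_le h1 h2 h3
    exact R.solA_differentiableOn (δ i).prop4 hVs (differentiableOn_const ((δ i).J U₀)) h𝔄d
      (fun _ _ => hJ) (fun σ hσ => h𝔄b σ hσ)

/-! ## §4 Dictionary: the typed Proposition 4 on this family is the input `Prop4Hyp` -/

omit [∀ i, CompleteSpace (𝒴f i)] in
/-- **Dictionary (no new content): on the model family the typed Proposition 4, `B11.Prop4Printed C₁ B₃ fam` (pp. 292–293: *"The
functional derivative of V(A′) is an analytic function on this space, and satisfies the estimate … (97) … |((δ/δA′)V)(A′)|_{(−3)} ≤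
C₄(max{|A′|_{(−1)}, |∇A′|_{(−2)}})², (98)"*), holds with the constants (a₃/2, C₄) — by the datum field `prop4 : Prop4Hyp W C₄ a₃`,
i.e. BY HYPOTHESIS: Proposition 4 is an INPUT of this model, typed in the tree and NOT proved (its display-level pieces (85)–(96) are the
r08 modules `B11Eq85FirstDerivative`, `B11Eq88Estimate`, `B11Eq93Commutator`).  Radius a₃/2 because `Prop4Hyp` is stated on the open
ball ‖·‖ < a₃ while (98) is typed with «≤ a₃». [cite: Balaban1985Variational, Prop. 4 (97)–(98) pp.292–293] -/
theorem prop4Printed_model {B₀ C₄ a₃ B₃ C₁ : ℝ} (hC₄ : 0 < C₄) (ha₃ : 0 < a₃)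
    (δ : ∀ i, SchemeDatum (𝒴f i) (𝒵f i) (Cfgf i) (Bdryf i) B₀ C₄ a₃ B₃) :
    B11.Prop4Printed C₁ B₃ (fun i => (δ i).toLGData C₁) := by
  refine ⟨a₃ / 2, C₄, 1, by positivity, hC₄, one_pos, ?_⟩
  intro i ε₁ _ _ V U₀ _
  dsimp only [SchemeDatum.toLGData]
  refine ⟨fun ε₃ hε₃ hε₃a => ⟨?_, fun A hA => ?_⟩, fun A hA => ?_⟩
  · exact (δ i).prop4.differentiableOn.mono fun Y (hY : ‖Y‖ < ε₃) => show ‖Y‖ < a₃ by linarith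
  · have hq := (δ i).prop4.quad A (by linarith)
    have h0 : 0 ≤ ‖A‖ := norm_nonneg _
    have hsq : ‖A‖ ^ 2 < ε₃ ^ 2 := by nlinarith
    exact hq.trans_lt (mul_lt_mul_of_pos_left hsq hC₄)
  · exact (δ i).prop4.quad A (by linarith)

end Family

end Literature.MathematicalPhysics.QuantumFieldTheory.Balaban1983to89.B11Prop6Model

end
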